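import Summits.CriticalPhenomena.PercolationContinuityZ3.Theorems.Transplant.FKConnectivityAllQForestClawDecomposition
import Summits.CriticalPhenomena.PercolationContinuityZ3.Theorems.Transplant.FKConnectivityAllQForestNearTight
import HarnessLib

/-!
# Tools for the TREE LEVEL of the square-free adjacent forest Rayleigh node: fibre counting, vanishing on tight fibres,
# degree-two / pendant / mixed vertex eliminations, and the degree-two exchange at `v`

Support file (`--supports stmt-CriticalPhenomena-4575`), FK sub-lane `prim-bschramm-fk-1` (generation 29) of the post-continuity
programme; builds on p205010 (kernel theorem, internal audit signed; external expert review pending).  No definitions, no named facts,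
no sorries; standard axioms.  Part 1 of 2 (part 2: `…ForestTreeLevel`, the tree-level theorem).

SETTING.  A fibre `(M, u₀)` on the vertex type `V` (`M` free pairs, `u₀` pinned pairs, `Disjoint u₀ M`) whose pairs all lie inside a
finite vertex set `S`; `W := |M| + 2|u₀|` is the number of pairs of the underlying multigraph (pinned pairs counted twice: they lie
in both classes).  For a configuration `ω` of the fibre (`ω ∖ M = u₀`) with `ω` and its partner `ω ∆ M` both forests, write `c_A`,
`c_B` for the numbers of open clusters of `ω`, `ω ∆ M` met by `S`.
* **`ncard_add_ncard_symmDiff_of_fibre`**: `|ω| + |ω ∆ M| = |M| + 2|u₀|`;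
* **`card_image_add_of_fibre`**: `c_A + c_B + W = 2|S|` (from `|X| + #{clusters met by S} = |S|` for a forest inside `S`,
  `ncard_add_card_image_eq` of `…ForestNearTight`);
* hence on a TIGHT fibre (`2|S| ≤ W + 2`) both classes join `S` pairwise (**`reachable_of_tight`**, **`reachable_symmDiff_of_tight`**)
  and on a NEAR-TIGHT fibre (`2|S| ≤ W + 3`) no class separates three vertices of `S` pairwise; the corresponding fibre counts
  VANISH (**`fibreCount_sep_eq_zero_of_tight`**, **`fibreCount_sep₃_eq_zero_of_nearTight`** and primed partner forms).
* Vertex eliminations at a vertex `z` isolated in the rest, for events blind to the pairs at `z` (companions of the claw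
  decomposition `fibreCount_forest_claw_decomp` of `…ForestClawDecomposition`):
  **`fibreCount_forest_degTwo_decomp`** (two free pairs `za, zb`: `# = #'(S_ab‖·) + #'(·‖S_ab) + 2#'`),
  **`fibreCount_forest_pendantPinned`** (one pinned pair `zh`: `# = #'`),
  **`fibreCount_forest_mixed_decomp`** (one free pair `zi`, one pinned pair `zh`: `# = #'(S_hi‖·) + #'(·‖S_hi)`).
* **`adjForestNoSq_bad_sdiff_le_good_of_degTwo`**: if the pairs of the fibre at `v` are exactly `e = ov` and one more free pair
  `g = vw`, then `#(Fo ∩ {e, f ∈ ω} ∩ {g ∉ ω}, Fo) ≤ #(Fo ∩ {e ∈ ω}, Fo ∩ {f ∈ ω})` — the Cibulka–Hladký–LaCroix–Wagner exchange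
  `(A, B) ↦ (B − g + e, A − e + g)` at a vertex of degree two (their Case 2(ii)), as an exchange injection followed by the class swap.
These are the ingredients of the tree-level theorem (part 2): the node's inequality on every tight fibre, i.e. the ADJACENT case of
Cibulka–Hladký–LaCroix–Wagner's Rayleigh identity `T_e^f T_f^e − T_{ef} T^{ef} = (X⁺ − X⁻)²` where `X⁺ = 0` for an adjacent pair.
[cite: CibulkaHladkyLaCroixWagner2008, Thm. 1 (p. 2), Cases 2–3 (pp. 4–5)] [cite: Linusson2011, Prop. 2.6] [cite: Grimmett2006, §1.5 (p. 13)]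
-/

noncomputable section

namespace Summit.CriticalPhenomena.PercolationContinuityZ3.Theorems
namespace FK

open MeasureTheory Set Literature.Probability.LatticeModels Literature.Probability.Percolation
open scoped Classical symmDiff

variable {V : Type*} [Fintype V]

/-! ### Counting on a fibre inside a finite vertex set -/

section Counting

variable {M u₀ : BondConfig V} {S : Finset V}

/-- **Size identity on a fibre**: `|ω| + |ω ∆ M| = |M| + 2|u₀|` for `ω ∖ M = u₀`. [cite: Linusson2011, Prop. 2.6] -/
theorem ncard_add_ncard_symmDiff_of_fibre {ω : BondConfig V} (hω : ω \ M = u₀) :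
    ω.ncard + (ω ∆ M).ncard = M.ncard + 2 * u₀.ncard := by
  have h1 : ω ∩ M ∪ ω \ M = ω := Set.inter_union_sdiff ω M
  have hdisj1 : Disjoint (ω ∩ M) (ω \ M) := Set.disjoint_left.2 fun x hx hx' => hx'.2 hx.2
  have e1 : ω.ncard = (ω ∩ M).ncard + u₀.ncard := by
    rw [← hω]
    conv_lhs => rw [← h1]
    rw [Set.ncard_union_eq hdisj1 (toFinite _) (toFinite _)]
  have h2 : ω ∆ M = (ω \ M) ∪ (M \ ω) := Set.symmDiff_def ω M
  have hdisj2 : Disjoint (ω \ M) (M \ ω) := Set.disjoint_left.2 fun x hx hx' => hx.2 hx'.1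
  have e2 : (ω ∆ M).ncard = u₀.ncard + (M \ ω).ncard := by
    rw [h2, Set.ncard_union_eq hdisj2 (toFinite _) (toFinite _), hω]
  have e3 : (M ∩ ω).ncard + (M \ ω).ncard = M.ncard := Set.ncard_inter_add_ncard_sdiff_eq_ncard M ω (toFinite _)
  rw [Set.inter_comm] at e1
  omega

/-- **`c_A + c_B + W = 2|S|`**: for a fibre inside `S` and a configuration whose two classes are forests, the numbers of clusters
of the two classes met by `S` add up with the pair count `W = |M| + 2|u₀|` to `2|S|`. [cite: Grimmett2006, §1.5 (p. 13)]
[cite: Linusson2011, Prop. 2.6] -/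
theorem card_image_add_of_fibre (hS : ∀ g ∈ M ∪ u₀, ∀ w ∈ g, w ∈ S) {ω : BondConfig V}
    (hω : ω \ M = u₀) (hA : IsForestCfg ω) (hB : IsForestCfg (ω ∆ M)) :
    (S.image (openGraph ω).connectedComponentMk).card + (S.image (openGraph (ω ∆ M)).connectedComponentMk).card +
      (M.ncard + 2 * u₀.ncard) = 2 * S.card := by
  have hsub := subset_union_of_fibre hω
  have h1 := ncard_add_card_image_eq (U := S) hA (fun g hg w hw => hS g (hsub.1 hg) w hw)
  have h2 := ncard_add_card_image_eq (U := S) hB (fun g hg w hw => hS g (hsub.2 hg) w hw)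
  have h3 := ncard_add_ncard_symmDiff_of_fibre (M := M) (u₀ := u₀) hω
  omega

/-- **On a tight fibre the configuration joins `S` pairwise.** (`2|S| ≤ W + 2`.) [cite: CibulkaHladkyLaCroixWagner2008, Thm. 1 (p. 2)] -/
theorem reachable_of_tight (hS : ∀ g ∈ M ∪ u₀, ∀ w ∈ g, w ∈ S)
    (ht : 2 * S.card ≤ M.ncard + 2 * u₀.ncard + 2) {ω : BondConfig V} (hω : ω \ M = u₀) (hA : IsForestCfg ω)
    (hB : IsForestCfg (ω ∆ M)) {a b : V} (ha : a ∈ S) (hb : b ∈ S) : (openGraph ω).Reachable a b := by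
  have h := card_image_add_of_fibre hS hω hA hB
  have h1 : 1 ≤ (S.image (openGraph (ω ∆ M)).connectedComponentMk).card :=
    Finset.card_pos.2 ⟨_, Finset.mem_image_of_mem _ ha⟩
  exact reachable_of_card_image_le_one (by omega) ha hb

/-- **On a tight fibre the partner joins `S` pairwise.** [cite: CibulkaHladkyLaCroixWagner2008, Thm. 1 (p. 2)] -/
theorem reachable_symmDiff_of_tight (hS : ∀ g ∈ M ∪ u₀, ∀ w ∈ g, w ∈ S)
    (ht : 2 * S.card ≤ M.ncard + 2 * u₀.ncard + 2) {ω : BondConfig V} (hω : ω \ M = u₀) (hA : IsForestCfg ω)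
    (hB : IsForestCfg (ω ∆ M)) {a b : V} (ha : a ∈ S) (hb : b ∈ S) : (openGraph (ω ∆ M)).Reachable a b := by
  have h := card_image_add_of_fibre hS hω hA hB
  have h1 : 1 ≤ (S.image (openGraph ω).connectedComponentMk).card :=
    Finset.card_pos.2 ⟨_, Finset.mem_image_of_mem _ ha⟩
  exact reachable_of_card_image_le_one (by omega) ha hb

/-- **On a near-tight fibre no class separates three vertices of `S` pairwise.** (`2|S| ≤ W + 3`.) [cite: Grimmett2006, §1.5 (p. 13)] -/
theorem reachable_or_of_nearTight (hS : ∀ g ∈ M ∪ u₀, ∀ w ∈ g, w ∈ S)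
    (ht : 2 * S.card ≤ M.ncard + 2 * u₀.ncard + 3) {ω : BondConfig V} (hω : ω \ M = u₀) (hA : IsForestCfg ω)
    (hB : IsForestCfg (ω ∆ M)) {a b c : V} (ha : a ∈ S) (hb : b ∈ S) (hc : c ∈ S) :
    (openGraph ω).Reachable a b ∨ (openGraph ω).Reachable a c ∨ (openGraph ω).Reachable b c := by
  have h := card_image_add_of_fibre hS hω hA hB
  have h1 : 1 ≤ (S.image (openGraph (ω ∆ M)).connectedComponentMk).card :=
    Finset.card_pos.2 ⟨_, Finset.mem_image_of_mem _ ha⟩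
  exact reachable_or_of_card_image_le_two (by omega) ha hb hc

/-- Partner form of `reachable_or_of_nearTight`. [cite: Grimmett2006, §1.5 (p. 13)] -/
theorem reachable_or_symmDiff_of_nearTight (hS : ∀ g ∈ M ∪ u₀, ∀ w ∈ g, w ∈ S)
    (ht : 2 * S.card ≤ M.ncard + 2 * u₀.ncard + 3) {ω : BondConfig V} (hω : ω \ M = u₀) (hA : IsForestCfg ω)
    (hB : IsForestCfg (ω ∆ M)) {a b c : V} (ha : a ∈ S) (hb : b ∈ S) (hc : c ∈ S) :
    (openGraph (ω ∆ M)).Reachable a b ∨ (openGraph (ω ∆ M)).Reachable a c ∨ (openGraph (ω ∆ M)).Reachable b c := by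
  have h := card_image_add_of_fibre hS hω hA hB
  have h1 : 1 ≤ (S.image (openGraph ω).connectedComponentMk).card :=
    Finset.card_pos.2 ⟨_, Finset.mem_image_of_mem _ ha⟩
  exact reachable_or_of_card_image_le_two (by omega) ha hb hc

/-- **VANISHING on a tight fibre**: a count whose configuration separates two vertices of `S` is zero.
[cite: CibulkaHladkyLaCroixWagner2008, Thm. 1 (p. 2)] [cite: Linusson2011, Prop. 2.6] -/
theorem fibreCount_sep_eq_zero_of_tight (hS : ∀ g ∈ M ∪ u₀, ∀ w ∈ g, w ∈ S)
    (ht : 2 * S.card ≤ M.ncard + 2 * u₀.ncard + 2) {a b : V} (ha : a ∈ S) (hb : b ∈ S) (P Q : Set (BondConfig V)) :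
    fibreCount M u₀ (forestEv V ∩ {ω | ¬ (openGraph ω).Reachable a b} ∩ P) (forestEv V ∩ Q) = 0 :=
  fibreCount_eq_zero_of_forall M u₀ _ _ fun _ hω hA hB => hA.1.2 (reachable_of_tight hS ht hω hA.1.1 hB.1 ha hb)

/-- Partner form of `fibreCount_sep_eq_zero_of_tight`. [cite: Linusson2011, Prop. 2.6] -/
theorem fibreCount_sep_eq_zero_of_tight' (hS : ∀ g ∈ M ∪ u₀, ∀ w ∈ g, w ∈ S)
    (ht : 2 * S.card ≤ M.ncard + 2 * u₀.ncard + 2) {a b : V} (ha : a ∈ S) (hb : b ∈ S) (P Q : Set (BondConfig V)) :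
    fibreCount M u₀ (forestEv V ∩ P) (forestEv V ∩ {ω | ¬ (openGraph ω).Reachable a b} ∩ Q) = 0 :=
  fibreCount_eq_zero_of_forall M u₀ _ _ fun _ hω hA hB => hB.1.2 (reachable_symmDiff_of_tight hS ht hω hA.1 hB.1.1 ha hb)

/-- **VANISHING on a near-tight fibre**: a count whose configuration separates three vertices of `S` pairwise is zero.
[cite: Grimmett2006, §1.5 (p. 13)] [cite: Linusson2011, Prop. 2.6] -/
theorem fibreCount_sep₃_eq_zero_of_nearTight (hS : ∀ g ∈ M ∪ u₀, ∀ w ∈ g, w ∈ S)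
    (ht : 2 * S.card ≤ M.ncard + 2 * u₀.ncard + 3) {a b c : V} (ha : a ∈ S) (hb : b ∈ S) (hc : c ∈ S)
    (P Q : Set (BondConfig V)) :
    fibreCount M u₀ (forestEv V ∩ {ω | ¬ (openGraph ω).Reachable a b ∧ ¬ (openGraph ω).Reachable a c ∧
      ¬ (openGraph ω).Reachable b c} ∩ P) (forestEv V ∩ Q) = 0 :=
  fibreCount_eq_zero_of_forall M u₀ _ _ fun _ hω hA hB => by
    rcases reachable_or_of_nearTight hS ht hω hA.1.1 hB.1 ha hb hc with h | h | h
    · exact hA.1.2.1 h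
    · exact hA.1.2.2.1 h
    · exact hA.1.2.2.2 h

/-- Partner form of `fibreCount_sep₃_eq_zero_of_nearTight`. [cite: Linusson2011, Prop. 2.6] -/
theorem fibreCount_sep₃_eq_zero_of_nearTight' (hS : ∀ g ∈ M ∪ u₀, ∀ w ∈ g, w ∈ S)
    (ht : 2 * S.card ≤ M.ncard + 2 * u₀.ncard + 3) {a b c : V} (ha : a ∈ S) (hb : b ∈ S) (hc : c ∈ S)
    (P Q : Set (BondConfig V)) :
    fibreCount M u₀ (forestEv V ∩ P) (forestEv V ∩ {ω | ¬ (openGraph ω).Reachable a b ∧ ¬ (openGraph ω).Reachable a c ∧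
      ¬ (openGraph ω).Reachable b c} ∩ Q) = 0 :=
  fibreCount_eq_zero_of_forall M u₀ _ _ fun _ hω hA hB => by
    rcases reachable_or_symmDiff_of_nearTight hS ht hω hA.1 hB.1.1 ha hb hc with h | h | h
    · exact hB.1.2.1 h
    · exact hB.1.2.2.1 h
    · exact hB.1.2.2.2 h

end Counting

/-! ### Vertex eliminations at a vertex isolated in the rest -/

section Elim

variable {M' u₀ : BondConfig V} {z a b h i : V} {P Q : Set (BondConfig V)}

/-- **Degree-two elimination (two free pairs).**  `z` isolated in `M' ∪ u₀`, `z, a, b` distinct, `P, Q` blind to `za, zb`: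
`#_{({za,zb} ∪ M', u₀)}(Fo ∩ P, Fo ∩ Q) = #'(Fo ∩ S_ab ∩ P, Fo ∩ Q) + #'(Fo ∩ P, Fo ∩ S_ab ∩ Q) + 2·#'(Fo ∩ P, Fo ∩ Q)`
(`#'` on `(M', u₀)`; the two pairs in one class separate `a, b` there, one pair in each class is free).
[cite: CibulkaHladkyLaCroixWagner2008, Case 2 (p. 4)] [cite: Linusson2011, Prop. 2.6] -/
theorem fibreCount_forest_degTwo_decomp (hz : ∀ g ∈ M' ∪ u₀, z ∉ g) (hza : z ≠ a) (hzb : z ≠ b) (hab : a ≠ b)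
    (hPa : ∀ ω, insert s(z, a) ω ∈ P ↔ ω ∈ P) (hPb : ∀ ω, insert s(z, b) ω ∈ P ↔ ω ∈ P)
    (hQa : ∀ ω, insert s(z, a) ω ∈ Q ↔ ω ∈ Q) (hQb : ∀ ω, insert s(z, b) ω ∈ Q ↔ ω ∈ Q) :
    fibreCount (insert s(z, a) (insert s(z, b) M')) u₀ (forestEv V ∩ P) (forestEv V ∩ Q) =
      (fibreCount M' u₀ (forestEv V ∩ {ω | ¬ (openGraph ω).Reachable a b} ∩ P) (forestEv V ∩ Q) +
        fibreCount M' u₀ (forestEv V ∩ P) (forestEv V ∩ {ω | ¬ (openGraph ω).Reachable a b} ∩ Q)) +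
      2 * fibreCount M' u₀ (forestEv V ∩ P) (forestEv V ∩ Q) := by
  have hza' : s(z, a) ∉ insert s(z, b) M' := by
    simp only [mem_insert_iff, not_or]
    exact ⟨fun h => hab (Sym2.congr_right.1 h), fun h => hz _ (Or.inl h) (Sym2.mem_mk_left _ _)⟩
  have hzb' : s(z, b) ∉ M' := fun h => hz _ (Or.inl h) (Sym2.mem_mk_left _ _)
  have hiso : ∀ {ω : BondConfig V}, ω \ M' = u₀ → (∀ g ∈ ω, z ∉ g) ∧ (∀ g ∈ ω ∆ M', z ∉ g) := fun {ω} hω =>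
    ⟨fun g hg => hz g ((subset_union_of_fibre hω).1 hg), fun g hg => hz g ((subset_union_of_fibre hω).2 hg)⟩
  rw [fibreCount_insert_one hza', fibreCount_insert_one hzb', fibreCount_insert_one hzb']
  have pack : ∀ {ξ : BondConfig V}, (∀ g ∈ ξ, z ∉ g) →
      (s(z, a) ∉ ξ ∧ s(z, b) ∉ ξ) ∧
      ((IsForestCfg (insert s(z, a) (insert s(z, b) ξ)) ↔ IsForestCfg ξ ∧ ¬ (openGraph ξ).Reachable a b) ∧
        (IsForestCfg (insert s(z, a) ξ) ↔ IsForestCfg ξ) ∧ (IsForestCfg (insert s(z, b) ξ) ↔ IsForestCfg ξ)) := by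
    intro ξ hξ
    refine ⟨⟨notMem_of_isolated hξ a, notMem_of_isolated hξ b⟩, ?_,
      isForestCfg_insert_of_isolated hξ hza, isForestCfg_insert_of_isolated hξ hzb⟩
    rw [isForestCfg_insert_two_of_isolated hξ hzb hza hab.symm, SimpleGraph.reachable_comm]
  have hab' : s(z, a) ≠ s(z, b) := fun h => hab (Sym2.congr_right.1 h)
  have e1 : fibreCount M' u₀
      ({ω | s(z, b) ∉ ω} ∩ {ω | insert s(z, b) ω ∈ {ω | s(z, a) ∉ ω} ∩ {ω | insert s(z, a) ω ∈ forestEv V ∩ P}})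
      ({ω | s(z, b) ∉ ω} ∩ ({ω | s(z, a) ∉ ω} ∩ (forestEv V ∩ Q))) =
      fibreCount M' u₀ (forestEv V ∩ {ω | ¬ (openGraph ω).Reachable a b} ∩ P) (forestEv V ∩ Q) :=
    fibreCount_congr_fibre _ _ fun ω hω => by
      obtain ⟨⟨n1, n2⟩, f2, fa, fb⟩ := pack (hiso hω).1
      obtain ⟨⟨m1, m2⟩, g2, ga, gb⟩ := pack (hiso hω).2
      simp only [mem_inter_iff, mem_setOf_eq, forestEv, mem_insert_iff, hab', n1, n2, m1, m2, f2, hPa, hPb,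
        not_false_eq_true, true_and, false_or]
  have e2 : fibreCount M' u₀
      ({ω | s(z, b) ∉ ω} ∩ ({ω | s(z, a) ∉ ω} ∩ {ω | insert s(z, a) ω ∈ forestEv V ∩ P}))
      ({ω | s(z, b) ∉ ω} ∩ {ω | insert s(z, b) ω ∈ {ω | s(z, a) ∉ ω} ∩ (forestEv V ∩ Q)}) =
      fibreCount M' u₀ (forestEv V ∩ P) (forestEv V ∩ Q) :=
    fibreCount_congr_fibre _ _ fun ω hω => by
      obtain ⟨⟨n1, n2⟩, f2, fa, fb⟩ := pack (hiso hω).1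
      obtain ⟨⟨m1, m2⟩, g2, ga, gb⟩ := pack (hiso hω).2
      simp only [mem_inter_iff, mem_setOf_eq, forestEv, mem_insert_iff, hab', n1, n2, m1, m2, fa, gb, hPa, hQb,
        not_false_eq_true, true_and, false_or]
  have e3 : fibreCount M' u₀
      ({ω | s(z, b) ∉ ω} ∩ {ω | insert s(z, b) ω ∈ {ω | s(z, a) ∉ ω} ∩ (forestEv V ∩ P)})
      ({ω | s(z, b) ∉ ω} ∩ ({ω | s(z, a) ∉ ω} ∩ {ω | insert s(z, a) ω ∈ forestEv V ∩ Q})) =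
      fibreCount M' u₀ (forestEv V ∩ P) (forestEv V ∩ Q) :=
    fibreCount_congr_fibre _ _ fun ω hω => by
      obtain ⟨⟨n1, n2⟩, f2, fa, fb⟩ := pack (hiso hω).1
      obtain ⟨⟨m1, m2⟩, g2, ga, gb⟩ := pack (hiso hω).2
      simp only [mem_inter_iff, mem_setOf_eq, forestEv, mem_insert_iff, hab', n1, n2, m1, m2, fb, ga, hPb, hQa,
        not_false_eq_true, true_and, false_or]
  have e4 : fibreCount M' u₀
      ({ω | s(z, b) ∉ ω} ∩ ({ω | s(z, a) ∉ ω} ∩ (forestEv V ∩ P)))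
      ({ω | s(z, b) ∉ ω} ∩ {ω | insert s(z, b) ω ∈ {ω | s(z, a) ∉ ω} ∩ {ω | insert s(z, a) ω ∈ forestEv V ∩ Q}}) =
      fibreCount M' u₀ (forestEv V ∩ P) (forestEv V ∩ {ω | ¬ (openGraph ω).Reachable a b} ∩ Q) :=
    fibreCount_congr_fibre _ _ fun ω hω => by
      obtain ⟨⟨n1, n2⟩, f2, fa, fb⟩ := pack (hiso hω).1
      obtain ⟨⟨m1, m2⟩, g2, ga, gb⟩ := pack (hiso hω).2
      simp only [mem_inter_iff, mem_setOf_eq, forestEv, mem_insert_iff, hab', n1, n2, m1, m2, g2, hQa, hQb,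
        not_false_eq_true, true_and, false_or]
  rw [e1, e2, e3, e4]
  omega

/-- **Pendant pinned pair.**  `z` isolated in `M' ∪ u₀`, `z ≠ h`, `P, Q` blind to `zh`: pinning the pendant pair `zh` does not change
the count, `#_{(M', u₀ ∪ {zh})}(Fo ∩ P, Fo ∩ Q) = #_{(M', u₀)}(Fo ∩ P, Fo ∩ Q)`. [cite: CibulkaHladkyLaCroixWagner2008, §2 (p. 3)]
[cite: Linusson2011, Prop. 2.6] -/
theorem fibreCount_forest_pendantPinned (hz : ∀ g ∈ M' ∪ u₀, z ∉ g) (hzh : z ≠ h)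
    (hPh : ∀ ω, insert s(z, h) ω ∈ P ↔ ω ∈ P) (hQh : ∀ ω, insert s(z, h) ω ∈ Q ↔ ω ∈ Q) :
    fibreCount M' (insert s(z, h) u₀) (forestEv V ∩ P) (forestEv V ∩ Q) = fibreCount M' u₀ (forestEv V ∩ P) (forestEv V ∩ Q) := by
  have hM : s(z, h) ∉ M' := fun hg => hz _ (Or.inl hg) (Sym2.mem_mk_left _ _)
  have hu : s(z, h) ∉ u₀ := fun hg => hz _ (Or.inr hg) (Sym2.mem_mk_left _ _)
  have hiso : ∀ {ω : BondConfig V}, ω \ M' = u₀ → (∀ g ∈ ω, z ∉ g) ∧ (∀ g ∈ ω ∆ M', z ∉ g) := fun {ω} hω =>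
    ⟨fun g hg => hz g ((subset_union_of_fibre hω).1 hg), fun g hg => hz g ((subset_union_of_fibre hω).2 hg)⟩
  rw [fibreCount_insert_pinned hM hu]
  refine fibreCount_congr_fibre _ _ fun ω hω => ?_
  simp only [mem_setOf_eq, mem_inter_iff, forestEv, isForestCfg_insert_of_isolated (hiso hω).1 hzh, hPh,
    isForestCfg_insert_of_isolated (hiso hω).2 hzh, hQh]

/-- **Mixed elimination (one free pair `zi`, one pinned pair `zh`).**  `z` isolated in `M' ∪ u₀`, `z, h, i` distinct, `P, Q` blind to
`zi, zh`: `#_{(M' ∪ {zi}, u₀ ∪ {zh})}(Fo ∩ P, Fo ∩ Q) = #'(Fo ∩ S_hi ∩ P, Fo ∩ Q) + #'(Fo ∩ P, Fo ∩ S_hi ∩ Q)` (`#'` on `(M', u₀)`):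
the class holding both pairs at `z` separates `h, i` in the rest, in the other class `z` is a leaf.
[cite: CibulkaHladkyLaCroixWagner2008, Case 3 (pp. 4–5)] [cite: Linusson2011, Prop. 2.6] -/
theorem fibreCount_forest_mixed_decomp (hz : ∀ g ∈ M' ∪ u₀, z ∉ g) (hzh : z ≠ h) (hzi : z ≠ i) (hhi : h ≠ i)
    (hPi : ∀ ω, insert s(z, i) ω ∈ P ↔ ω ∈ P) (hPh : ∀ ω, insert s(z, h) ω ∈ P ↔ ω ∈ P)
    (hQi : ∀ ω, insert s(z, i) ω ∈ Q ↔ ω ∈ Q) (hQh : ∀ ω, insert s(z, h) ω ∈ Q ↔ ω ∈ Q) :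
    fibreCount (insert s(z, i) M') (insert s(z, h) u₀) (forestEv V ∩ P) (forestEv V ∩ Q) =
      fibreCount M' u₀ (forestEv V ∩ {ω | ¬ (openGraph ω).Reachable h i} ∩ P) (forestEv V ∩ Q) +
        fibreCount M' u₀ (forestEv V ∩ P) (forestEv V ∩ {ω | ¬ (openGraph ω).Reachable h i} ∩ Q) := by
  have hiM : s(z, i) ∉ M' := fun hg => hz _ (Or.inl hg) (Sym2.mem_mk_left _ _)
  have hhM : s(z, h) ∉ M' := fun hg => hz _ (Or.inl hg) (Sym2.mem_mk_left _ _)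
  have hhu : s(z, h) ∉ u₀ := fun hg => hz _ (Or.inr hg) (Sym2.mem_mk_left _ _)
  have hiso : ∀ {ω : BondConfig V}, ω \ M' = u₀ → (∀ g ∈ ω, z ∉ g) ∧ (∀ g ∈ ω ∆ M', z ∉ g) := fun {ω} hω =>
    ⟨fun g hg => hz g ((subset_union_of_fibre hω).1 hg), fun g hg => hz g ((subset_union_of_fibre hω).2 hg)⟩
  have hih : s(z, i) ≠ s(z, h) := fun h' => hhi (Sym2.congr_right.1 h').symm
  rw [fibreCount_insert_one hiM, fibreCount_insert_pinned hhM hhu, fibreCount_insert_pinned hhM hhu]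
  have pack : ∀ {ξ : BondConfig V}, (∀ g ∈ ξ, z ∉ g) →
      (s(z, i) ∉ ξ ∧ s(z, h) ∉ ξ) ∧
      ((IsForestCfg (insert s(z, i) (insert s(z, h) ξ)) ↔ IsForestCfg ξ ∧ ¬ (openGraph ξ).Reachable h i) ∧
        (IsForestCfg (insert s(z, h) ξ) ↔ IsForestCfg ξ)) := fun {ξ} hξ =>
    ⟨⟨notMem_of_isolated hξ i, notMem_of_isolated hξ h⟩, isForestCfg_insert_two_of_isolated hξ hzh hzi hhi,
      isForestCfg_insert_of_isolated hξ hzh⟩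
  congr 1
  · refine fibreCount_congr_fibre _ _ fun ω hω => ?_
    obtain ⟨⟨n1, n2⟩, f2, fh⟩ := pack (hiso hω).1
    obtain ⟨⟨m1, m2⟩, g2, gh⟩ := pack (hiso hω).2
    simp only [mem_setOf_eq, mem_inter_iff, forestEv, mem_insert_iff, hih, n1, m1, f2, gh, hPi, hPh, hQh,
      not_false_eq_true, true_and, false_or]
  · refine fibreCount_congr_fibre _ _ fun ω hω => ?_
    obtain ⟨⟨n1, n2⟩, f2, fh⟩ := pack (hiso hω).1
    obtain ⟨⟨m1, m2⟩, g2, gh⟩ := pack (hiso hω).2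
    simp only [mem_setOf_eq, mem_inter_iff, forestEv, mem_insert_iff, hih, n1, m1, fh, g2, hPh, hQi, hQh,
      not_false_eq_true, true_and, false_or]

end Elim

/-! ### The degree-two exchange at `v` -/

section Exchange

variable {M u₀ : BondConfig V} {o v w y : V}

/-- **The Cibulka–Hladký–LaCroix–Wagner exchange at a vertex of degree two.**  If the pairs of `M ∪ u₀` at `v` are exactly the
two free pairs `e = ov` and `g = vw` (`o, v, w` distinct, `v ≠ y`), then
`#(Fo ∩ {e, f ∈ ω} ∩ {g ∉ ω}, Fo) ≤ #(Fo ∩ {e ∈ ω}, Fo ∩ {f ∈ ω})` (`f = oy`): the exchange `ω ↦ ω − e + g` (valid since `v` is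
then isolated on both sides) lands in `#(Fo ∩ {f ∈ ω}, Fo ∩ {e ∈ ω})`, which is the right-hand side by the class swap.
[cite: CibulkaHladkyLaCroixWagner2008, Case 2(ii) (p. 4)] [cite: Linusson2011, Prop. 2.6] -/
theorem adjForestNoSq_bad_sdiff_le_good_of_degTwo (hov : o ≠ v) (hvw : v ≠ w) (how : o ≠ w) (hvy : v ≠ y)
    (heM : s(o, v) ∈ M) (hgM : s(v, w) ∈ M) (hv : ∀ p ∈ M ∪ u₀, v ∈ p → p = s(o, v) ∨ p = s(v, w)) :
    fibreCount M u₀ (forestEv V ∩ {ω | s(o, v) ∈ ω ∧ s(o, y) ∈ ω} ∩ {ω | s(v, w) ∉ ω}) (forestEv V) ≤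
      fibreCount M u₀ (forestEv V ∩ {ω | s(o, v) ∈ ω}) (forestEv V ∩ {ω | s(o, y) ∈ ω}) := by
  have hef : s(o, v) ≠ s(o, y) := fun h' => hvy (Sym2.congr_right.1 h')
  have heg : s(o, v) ≠ s(v, w) := fun h' => by
    rcases Sym2.eq_iff.1 h' with ⟨h1, _⟩ | ⟨h1, _⟩
    · exact hov h1
    · exact how h1
  calc fibreCount M u₀ (forestEv V ∩ {ω | s(o, v) ∈ ω ∧ s(o, y) ∈ ω} ∩ {ω | s(v, w) ∉ ω}) (forestEv V)
      ≤ fibreCount M u₀ (forestEv V ∩ {ω | s(o, y) ∈ ω}) (forestEv V ∩ {ω | s(o, v) ∈ ω}) := by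
        refine fibreCount_exchange_le_of heM hgM fun ω hω hA hB => ?_
        obtain ⟨⟨hF, he, hf⟩, hg⟩ := hA
        have hF' : IsForestCfg (ω ∆ M) := hB
        have hg' : s(v, w) ∉ ω := hg
        have hsub := subset_union_of_fibre hω
        -- `v` is isolated in `ω − e` and in `(ω ∆ M) − g`
        have iso1 : ∀ p ∈ ω \ {s(o, v)}, v ∉ p := fun p hp hvp => by
          rcases hv p (hsub.1 hp.1) hvp with rfl | rfl
          · exact hp.2 rfl
          · exact hg' hp.1
        have heB : s(o, v) ∉ ω ∆ M := fun h' => ((Set.mem_symmDiff).1 h').elim (fun h'' => h''.2 heM) (fun h'' => h''.2 he)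
        have iso2 : ∀ p ∈ (ω ∆ M) \ {s(v, w)}, v ∉ p := fun p hp hvp => by
          rcases hv p (hsub.2 hp.1) hvp with rfl | rfl
          · exact heB hp.1
          · exact hp.2 rfl
        refine ⟨he, hg', ⟨?_, ?_⟩, ⟨?_, mem_insert _ _⟩⟩
        · exact (isForestCfg_insert_of_isolated iso1 hvw).2 (isForestCfg_of_subset hF sdiff_subset)
        · exact mem_insert_of_mem _ ⟨hf, fun h' => hef (mem_singleton_iff.1 h').symm⟩
        · have h' := (isForestCfg_insert_of_isolated iso2 hov.symm).2 (isForestCfg_of_subset hF' sdiff_subset)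
          rwa [Sym2.eq_swap] at h'
    _ = fibreCount M u₀ (forestEv V ∩ {ω | s(o, v) ∈ ω}) (forestEv V ∩ {ω | s(o, y) ∈ ω}) := fibreCount_swap _ _ _ _

end Exchange

end FK
end Summit.CriticalPhenomena.PercolationContinuityZ3.Theorems

end
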